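import Summits.HodgeConjecture.HodgeConjecture.Theorems.F0P3cStCharTSRootRecip        -- ★ p851535 «ROOT-RECIP★» (R-level unitary reciprocity at root level)
import Summits.HodgeConjecture.HodgeConjecture.Theorems.F0P3cStCharTSEllOpen          -- ★ `evalPlace_injective`, `evalPlace_surjective`, `evalPlace_conjLocal`, `isRoot_map_iff_of_injective`
import HarnessLib

/-!
# F0 · P3c · line LH6 «StCharTS» — «NORM-ONE-PERSIST★» (brick (α) of S13b «UPR-LC», road (I) «moving norm-one roots»): read at the place `w ∣ v` (non-split), the roots of the
# characteristic polynomial of `y ∈ U(Φ₃)(L⁺_v)` are non-zero and pair off under `a ↦ (σ_w a)⁻¹`; hence a CONTINUOUSLY MOVING simple root `u(y)` that is isolated in a fixed window and is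
# NORM-ONE at `y₀` (`σ_w(u(y₀))·u(y₀) = 1`) stays norm-one for `y` near `y₀` [Rogawski1990, §3.1 p. 19; §12.2 p. 173; §12.5 pp. 182–184]

Cell `pub/hodgecm-mathlib`, crux H413 = `stmt-HodgeConjecture-24833` (lane `--supports … --as helper`), route HCCMUnconditional; seat F0P3-p02 (g20); datum road of the (S-𝔇)
organ `stub_EllipticPackage`; slice S13b «UPR-LC» (PLAN `F0/P3/F0P3-p02/g20/S13b-PLAN.v1.F0P3p02g20.md`), brick (α): it consumes the window clause of ★∕GREEN «MOVING-ROOT★»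
(LH4-p03 (g7), `exists_continuousAt_root`: `∃ δ u, 0 < δ ∧ u y₀ = a ∧ ContinuousAt u y₀ ∧ ∀ᶠ y in 𝓝 y₀, (f y).IsRoot (u y) ∧ ‖u y - a‖ < δ ∧ ∀ r, (f y).IsRoot r → ‖r - a‖ < δ → r = u y`)
VERBATIM as hypotheses (no import of that file is needed), at `f y := ((y.val : GL (Fin 3) R).val.charpoly).map (Pi.evalRingHom _ w)`.
THEOREMS ONLY (no definition ∕ instance ∕ notation ∕ named fact ∕ `sorry`); ★-only imports.
HONEST LABEL: HC_CM is proved only modulo the 7 printed citations (2 remaining named inputs: hLiu418 = `stmt-HodgeConjecture-24832`, h413 = `stmt-HodgeConjecture-24833`)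
until rung 0 closes; this file closes no organ, count-neutral.

* `ne_zero_of_isRoot_map_charpoly` — a root `a ∈ L_w` of `(charpoly Y)_w` is non-zero;
* `isRoot_map_charpoly_of_conj_mul_eq_one` — `P_w(a) = 0`, `σ_w(a)·a′ = 1 ⇒ P_w(a′) = 0` (transport of ★ `isRoot_charpoly_of_conj_mul_eq_one` along the bijection `R ≃ L_w`);
* `isRoot_map_charpoly_conj_inv` — `P_w(a) = 0 ⇒ P_w((σ_w a)⁻¹) = 0`;
* `eventually_conj_mul_self_eq_one` — THE PERSISTENCE: a moving isolated root that is norm-one at `y₀` is norm-one near `y₀`.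

## References
* [Rogawski1990] J. D. Rogawski, *Automorphic Representations of Unitary Groups in Three Variables*, Ann. of Math. Stud. 123 (1990): §3.1 p. 19; §12.2 p. 173 (eigenvalues
  `α, β, ᾱ⁻¹`); §12.5 pp. 182–184 (the functions `χ_ρ^G = "D_G⁻¹ Σ D_H χ_ρ"` near a regular point — the matched classes move continuously).
* [PlatonovRapinchuk1994] V. Platonov, A. Rapinchuk, *Algebraic Groups and Number Theory* (1994), §3.3 (continuity of roots over local fields) — background only.
-/

set_option autoImplicit false
-- the mandated namespace has the single-problem summit's repeated segment (`HodgeConjecture.HodgeConjecture`)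
set_option linter.dupNamespace false

noncomputable section

open Polynomial Filter Topology
open NumberField IsDedekindDomain
open scoped Matrix MatrixGroups
open Literature.NumberTheory.Automorphic Literature.NumberTheory.Automorphic.UnitaryGroup
open Literature.NumberTheory.Rogawski1990

namespace Summit.HodgeConjecture.HodgeConjecture.Cruxes.H413.F0P3cStCharTSNormOnePersist

variable (L : Type) [Field L] [NumberField L] [IsCMField L] (v : HeightOneSpectrum (𝓞 ↥(maximalRealSubfield L)))

/-! ## §1 Reciprocity of the roots read at the place `w` -/

/-- **A root `a ∈ L_w` of the characteristic polynomial of `y ∈ U(Φ₃)(L⁺_v)` read at `w` is non-zero** (it is the image of a unit of `R = L ⊗ L⁺_v`, ★ `isUnit_of_isRoot_charpoly`).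
[cite: Rogawski1990, §3.1 p. 19] -/
theorem ne_zero_of_isRoot_map_charpoly (w : PlacesOver L v) (hw : IsCMField.complexConj L • w.1 = w.1) (y : Gqs L v) {a : w.1.adicCompletion L}
    (ha : (((y.val : GL (Fin 3) (UnitaryGroup.LocalRing L v)).val.charpoly).map (Pi.evalRingHom (fun w' : PlacesOver L v => w'.1.adicCompletion L) w)).IsRoot a) :
    a ≠ 0 := by
  obtain ⟨u, rfl⟩ := F0P3cStCharTSEllOpen.evalPlace_surjective L v w hw a
  have hu : ((y.val : GL (Fin 3) (UnitaryGroup.LocalRing L v)).val.charpoly).IsRoot u :=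
    (F0P3cStCharTSEllOpen.isRoot_map_iff_of_injective _ (F0P3cStCharTSEllOpen.evalPlace_injective L v w hw) _ _).1 ha
  exact ((F0P3cStCharTSRootRecip.isUnit_of_isRoot_charpoly L v y hu).map _).ne_zero

/-- **Unitary reciprocity of the roots read at `w`**: `P_w(a) = 0` and `σ_w(a)·a′ = 1` imply `P_w(a′) = 0` (`σ_w = galAdicCompletionMap c`; transport of ★ `isRoot_charpoly_of_conj_mul_eq_one`
along `R ≃ L_w` at the unique `w ∣ v`, ★ `evalPlace_conjLocal`). [cite: Rogawski1990, §3.1 p. 19; §12.2 p. 173] -/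
theorem isRoot_map_charpoly_of_conj_mul_eq_one (w : PlacesOver L v) (hw : IsCMField.complexConj L • w.1 = w.1) (y : Gqs L v) {a a' : w.1.adicCompletion L}
    (ha : (((y.val : GL (Fin 3) (UnitaryGroup.LocalRing L v)).val.charpoly).map (Pi.evalRingHom (fun w' : PlacesOver L v => w'.1.adicCompletion L) w)).IsRoot a)
    (haa' : galAdicCompletionMap (L := L) (IsCMField.complexConj L) hw a * a' = 1) :
    (((y.val : GL (Fin 3) (UnitaryGroup.LocalRing L v)).val.charpoly).map (Pi.evalRingHom (fun w' : PlacesOver L v => w'.1.adicCompletion L) w)).IsRoot a' := by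
  have hinj := F0P3cStCharTSEllOpen.evalPlace_injective L v w hw
  obtain ⟨u, rfl⟩ := F0P3cStCharTSEllOpen.evalPlace_surjective L v w hw a
  obtain ⟨u', rfl⟩ := F0P3cStCharTSEllOpen.evalPlace_surjective L v w hw a'
  have hu : ((y.val : GL (Fin 3) (UnitaryGroup.LocalRing L v)).val.charpoly).IsRoot u :=
    (F0P3cStCharTSEllOpen.isRoot_map_iff_of_injective _ hinj _ _).1 ha
  have huu' : conjLocal L (IsCMField.complexConj L) v u * u' = 1 := by
    apply hinj
    rw [map_mul, map_one, F0P3cStCharTSEllOpen.evalPlace_conjLocal L v w hw u]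
    exact haa'
  exact (F0P3cStCharTSEllOpen.isRoot_map_iff_of_injective _ hinj _ _).2 (F0P3cStCharTSRootRecip.isRoot_charpoly_of_conj_mul_eq_one L v y hu huu')

/-- **Field form**: `P_w(a) = 0 ⇒ P_w((σ_w a)⁻¹) = 0`. [cite: Rogawski1990, §12.2 p. 173] -/
theorem isRoot_map_charpoly_conj_inv (w : PlacesOver L v) (hw : IsCMField.complexConj L • w.1 = w.1) (y : Gqs L v) {a : w.1.adicCompletion L}
    (ha : (((y.val : GL (Fin 3) (UnitaryGroup.LocalRing L v)).val.charpoly).map (Pi.evalRingHom (fun w' : PlacesOver L v => w'.1.adicCompletion L) w)).IsRoot a) :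
    (((y.val : GL (Fin 3) (UnitaryGroup.LocalRing L v)).val.charpoly).map (Pi.evalRingHom (fun w' : PlacesOver L v => w'.1.adicCompletion L) w)).IsRoot
      (galAdicCompletionMap (L := L) (IsCMField.complexConj L) hw a)⁻¹ := by
  have ha0 : galAdicCompletionMap (L := L) (IsCMField.complexConj L) hw a ≠ 0 :=
    (_root_.map_ne_zero _).2 (ne_zero_of_isRoot_map_charpoly L v w hw y ha)
  exact isRoot_map_charpoly_of_conj_mul_eq_one L v w hw y ha (mul_inv_cancel₀ ha0)

/-! ## §2 Persistence of norm-one roots -/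

/-- **NORM-ONE PERSISTENCE of a moving isolated root.**  Let `u : U(Φ₃)(L⁺_v) → L_w` be continuous at `y₀` with `u y₀ = a`, `σ_w(a)·a = 1`, and suppose that for `y` near `y₀` the value
`u y` is a root of `P_w(y) = (charpoly y)_w` and is the ONLY root within `δ` of `a` (the window clause of «MOVING-ROOT★» `exists_continuousAt_root`).  Then `σ_w(u y)·u y = 1` for `y`
near `y₀`: the partner root `(σ_w (u y))⁻¹` (★ `isRoot_map_charpoly_conj_inv`) tends to `(σ_w a)⁻¹ = a`, so it enters the window and equals `u y`.
[cite: Rogawski1990, §12.2 p. 173; §12.5 pp. 182–184] -/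
theorem eventually_conj_mul_self_eq_one (w : PlacesOver L v) (hw : IsCMField.complexConj L • w.1 = w.1) {y₀ : Gqs L v} {u : Gqs L v → w.1.adicCompletion L}
    {a : w.1.adicCompletion L} {δ : ℝ} (hδ : 0 < δ) (hu0 : u y₀ = a) (hu : ContinuousAt u y₀)
    (ha1 : galAdicCompletionMap (L := L) (IsCMField.complexConj L) hw a * a = 1)
    (hwin : ∀ᶠ y in 𝓝 y₀, (((y.val : GL (Fin 3) (UnitaryGroup.LocalRing L v)).val.charpoly).map (Pi.evalRingHom (fun w' : PlacesOver L v => w'.1.adicCompletion L) w)).IsRoot (u y) ∧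
      ‖u y - a‖ < δ ∧ ∀ r, (((y.val : GL (Fin 3) (UnitaryGroup.LocalRing L v)).val.charpoly).map (Pi.evalRingHom (fun w' : PlacesOver L v => w'.1.adicCompletion L) w)).IsRoot r →
        ‖r - a‖ < δ → r = u y) :
    ∀ᶠ y in 𝓝 y₀, galAdicCompletionMap (L := L) (IsCMField.complexConj L) hw (u y) * u y = 1 := by
  set σ := galAdicCompletionMap (L := L) (IsCMField.complexConj L) hw with hσ
  have ha0 : a ≠ 0 := by
    rintro rfl
    rw [mul_zero] at ha1
    exact zero_ne_one ha1
  have hσa0 : σ a ≠ 0 := (_root_.map_ne_zero σ).2 ha0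
  have hσa : (σ a)⁻¹ = a := by
    rw [inv_eq_iff_eq_inv]
    exact (eq_inv_of_mul_eq_one_left ha1)
  -- the partner root `g y := (σ (u y))⁻¹` is continuous at `y₀` with value `a`
  have hσu : ContinuousAt (fun y => σ (u y)) y₀ := (continuous_galAdicCompletionMap L (IsCMField.complexConj L) hw).continuousAt.comp hu
  have hg : ContinuousAt (fun y => (σ (u y))⁻¹) y₀ := hσu.inv₀ (by rw [hu0]; exact hσa0)
  have hball : ∀ᶠ y in 𝓝 y₀, ‖(σ (u y))⁻¹ - a‖ < δ := by
    have h : ∀ᶠ y in 𝓝 y₀, (σ (u y))⁻¹ ∈ Metric.ball ((fun y => (σ (u y))⁻¹) y₀) δ :=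
      hg.tendsto.eventually (Metric.ball_mem_nhds _ hδ)
    filter_upwards [h] with y hy
    rw [Metric.mem_ball, dist_eq_norm, hu0, hσa] at hy
    exact hy
  filter_upwards [hwin, hball] with y hy hgy
  obtain ⟨hroot, -, huniq⟩ := hy
  have hσuy0 : σ (u y) ≠ 0 := (_root_.map_ne_zero σ).2 (ne_zero_of_isRoot_map_charpoly L v w hw y hroot)
  have hpartner := isRoot_map_charpoly_conj_inv L v w hw y hroot
  have heq : (σ (u y))⁻¹ = u y := huniq _ hpartner hgy
  calc σ (u y) * u y = σ (u y) * (σ (u y))⁻¹ := by rw [heq]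
    _ = 1 := mul_inv_cancel₀ hσuy0

end Summit.HodgeConjecture.HodgeConjecture.Cruxes.H413.F0P3cStCharTSNormOnePersist

end
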